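import Mathlib
import Literature.Analysis.OperatorTheory.ContractiveDeterminantalRepresentation
import HarnessLib

/-!
# The Agler identity of a unitary colligation (polynomial form)

Topic `Literature/Analysis/OperatorTheory`; companion of `ContractiveDeterminantalRepresentation`
(vocabulary of Grinshpan–Kaliuzhnyi-Verbovetskyi–Woerdeman, arXiv:1208.2288: `blockVar κ = Z`,
transfer-function realizations (1.5) by a unitary colligation `U = [[A, B], [C, D]]`).
Requested by the line `birth` of crux `ValiantsHypothesis/ContractivityPrice.ContractiveHardness`
(lead c2): it is the algebraic bridge from "unitary realization of order `m`" to "Agler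
decomposition / Hermitian sum of squares of rank `m`" (Agler 1990; Knese, arXiv:1010.0715 Thm 2.1;
GKVW §2), which every attack on the line's hardness stub starts from.

## Statement

For a UNITARY `U` on `ℂ ⊕ ℂ^R` and a block structure `κ : Fin R → σ`, put `M = I − D Z`,
`s = det M`, `G = adj(M) C` (the state polynomial vector) and `r = A s + B Z G` (so that the
transfer function is `r/s`, cf. `IsRealizedBy`).  Then, as an identity of polynomials in two
independent sets of variables `z = X ∘ inl` and `w̄ = X ∘ inr` (the second copy carrying the
complex-conjugated coefficients),

  `s(z) s̄(w) − r(z) r̄(w) = Σ_i (1 − z_{κ i} w̄_{κ i}) · G_i(z) Ḡ_i(w)`.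

Proof: the state equation `G = C s + D Z G` (from `M adj(M) = det M · I`) says
`U (s, Z G) = (r, G)`; unitarity `U^* U = I` makes the formal Hermitian pairing of these two vectors
with themselves equal.  Grouping the `i`-th state coordinate gives the kernels
`K_i(z, w) = G_i(z) Ḡ_i(w)`: an Agler decomposition of the pair `(s, r)` of total rank `R`, rank
`m_j = #κ⁻¹(j)` in the variable `j`.

## Contents (theorems only)
* `conjCopy_C_mul`, bookkeeping for the conjugate copy `p ↦ rename inr (map conj p)`;
* `state_eq_of_adjugate` : the state equation `G_i = C_i s + Σ_j D_ij z_{κ j} G_j`;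
* `agler_identity_of_mem_unitaryGroup` : the identity above.
-/

noncomputable section

namespace Literature.Analysis.OperatorTheory

open MvPolynomial Matrix

variable {σ : Type*} {R : ℕ}

/-- The conjugate copy `p ↦ p̄(w)` (`rename inr ∘ map conj`) is conjugate-linear over the
constants: `(C a · p)‾ = C ā · p̄`. [folklore] -/
theorem conjCopy_C_mul (a : ℂ) (p : MvPolynomial σ ℂ) :
    rename (Sum.inr : σ → σ ⊕ σ) (MvPolynomial.map (starRingEnd ℂ) (C a * p)) =
      C (starRingEnd ℂ a) * rename (Sum.inr : σ → σ ⊕ σ) (MvPolynomial.map (starRingEnd ℂ) p) := by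
  rw [map_mul, map_C, map_mul, rename_C]

/-- **State equation.** For any square `D` (over the polynomial ring) and `M = I − D Z_κ`,
the vector `G = adj(M) c` satisfies `G_i = s · c_i + Σ_j D_ij · (z_{κ j} G_j)` with `s = det M`
(multiply `M · adj M = det M · I` by `c`). [folklore] -/
theorem state_eq_of_adjugate (κ : Fin R → σ) (D : Matrix (Fin R) (Fin R) (MvPolynomial σ ℂ))
    (c : Fin R → MvPolynomial σ ℂ) (i : Fin R) :
    ((1 - D * blockVar κ).adjugate *ᵥ c) i =
      (1 - D * blockVar κ).det * c i +
        ∑ j, D i j * (X (κ j) * ((1 - D * blockVar κ).adjugate *ᵥ c) j) := by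
  set M : Matrix (Fin R) (Fin R) (MvPolynomial σ ℂ) := 1 - D * blockVar κ with hM
  set G : Fin R → MvPolynomial σ ℂ := M.adjugate *ᵥ c with hG
  -- `M G = s • c`
  have h1 : M *ᵥ G = M.det • c := by
    rw [hG, Matrix.mulVec_mulVec, Matrix.mul_adjugate, Matrix.smul_mulVec, Matrix.one_mulVec]
  -- expand `M G = G − (D Z) G`
  have h2 : M *ᵥ G = G - (D * blockVar κ) *ᵥ G := by
    rw [hM, Matrix.sub_mulVec, Matrix.one_mulVec]
  have h3 := congrFun (h1.symm.trans h2) i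
  simp only [Pi.smul_apply, smul_eq_mul, Pi.sub_apply] at h3
  -- `h3 : s * c i = G i - ((D Z) G) i`
  have h4 : ((D * blockVar κ) *ᵥ G) i = ∑ j, D i j * (X (κ j) * G j) := by
    rw [← Matrix.mulVec_mulVec, Matrix.mulVec, dotProduct]
    refine Finset.sum_congr rfl fun j _ => ?_
    rw [blockVar, Matrix.mulVec_diagonal]
  rw [h4] at h3
  linear_combination (norm := ring_nf) -h3

/-- **The Agler identity of a unitary colligation** (polynomial, two-variable form).  For a unitary
`U = [[A, B], [C, D]]` on `ℂ ⊕ ℂ^R` and a block structure `κ`, with `M = I − D Z_κ`, `s = det M`,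
`G = adj(M) C`, `r = A s + B Z_κ G`:
`s(z) s̄(w) − r(z) r̄(w) = Σ_i (1 − z_{κ i} w̄_{κ i}) G_i(z) Ḡ_i(w)` in `ℂ[z, w̄]`
(`z = X ∘ inl`, `w̄ = X ∘ inr`, bars = conjugated coefficients).  This is the finite-dimensional
(lurking-isometry) computation behind "transfer-function realization of order `m` ⇒ Agler
decomposition with kernels of rank `m_j`" (Agler; Knese arXiv:1010.0715 Thm 2.1; GKVW 2012 §2).
[cite: GrinshpanKaliuzhnyiverbovetsWoerdeman2012, (1.5) and §2] -/
theorem agler_identity_of_mem_unitaryGroup (κ : Fin R → σ)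
    {U : Matrix (Fin 1 ⊕ Fin R) (Fin 1 ⊕ Fin R) ℂ} (hU : U ∈ Matrix.unitaryGroup (Fin 1 ⊕ Fin R) ℂ) :
    let D : Matrix (Fin R) (Fin R) (MvPolynomial σ ℂ) := (U.toBlocks₂₂).map C
    let s : MvPolynomial σ ℂ := (1 - D * blockVar κ).det
    let G : Fin R → MvPolynomial σ ℂ :=
      (1 - D * blockVar κ).adjugate *ᵥ fun i => C (U (Sum.inr i) (Sum.inl 0))
    let r : MvPolynomial σ ℂ :=
      C (U (Sum.inl 0) (Sum.inl 0)) * s + ∑ i, C (U (Sum.inl 0) (Sum.inr i)) * (X (κ i) * G i)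
    rename (Sum.inl : σ → σ ⊕ σ) s * rename (Sum.inr : σ → σ ⊕ σ) (MvPolynomial.map (starRingEnd ℂ) s) -
        rename (Sum.inl : σ → σ ⊕ σ) r * rename (Sum.inr : σ → σ ⊕ σ) (MvPolynomial.map (starRingEnd ℂ) r) =
      ∑ i, (1 - X (Sum.inl (κ i)) * X (Sum.inr (κ i))) *
        (rename (Sum.inl : σ → σ ⊕ σ) (G i) *
          rename (Sum.inr : σ → σ ⊕ σ) (MvPolynomial.map (starRingEnd ℂ) (G i))) := by
  intro D s G r
  -- the two copies
  set ι₁ : MvPolynomial σ ℂ →+* MvPolynomial (σ ⊕ σ) ℂ :=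
    (rename (Sum.inl : σ → σ ⊕ σ)).toRingHom with hι₁
  set ι₂ : MvPolynomial σ ℂ →+* MvPolynomial (σ ⊕ σ) ℂ :=
    (rename (Sum.inr : σ → σ ⊕ σ)).toRingHom.comp (MvPolynomial.map (starRingEnd ℂ)) with hι₂
  have hι₁C : ∀ (a : ℂ) (p : MvPolynomial σ ℂ), ι₁ (C a * p) = C a * ι₁ p := fun a p => by
    simp [hι₁]
  have hι₂C : ∀ (a : ℂ) (p : MvPolynomial σ ℂ), ι₂ (C a * p) = C (starRingEnd ℂ a) * ι₂ p :=
    fun a p => by simp [hι₂, map_C]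
  have hι₁X : ∀ (j : σ) (p : MvPolynomial σ ℂ), ι₁ (X j * p) = X (Sum.inl j) * ι₁ p := fun j p => by
    simp [hι₁, rename_X]
  have hι₂X : ∀ (j : σ) (p : MvPolynomial σ ℂ), ι₂ (X j * p) = X (Sum.inr j) * ι₂ p := fun j p => by
    simp [hι₂, map_X, rename_X]
  -- input and output vectors of the colligation
  set v : Fin 1 ⊕ Fin R → MvPolynomial σ ℂ := Sum.elim (fun _ => s) (fun j => X (κ j) * G j) with hv
  set u : Fin 1 ⊕ Fin R → MvPolynomial σ ℂ := Sum.elim (fun _ => r) G with hu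
  -- `u = U v` (state equation for the `inr` rows, definition of `r` for the `inl` row)
  have huv : ∀ k, u k = ∑ l, C (U k l) * v l := by
    intro k
    rcases k with k | i
    · have hk : k = 0 := Subsingleton.elim _ _
      subst hk
      simp only [hu, hv, Sum.elim_inl, Fintype.sum_sum_type, Finset.univ_unique,
        Finset.sum_singleton, Sum.elim_inr, Fin.default_eq_zero]
      rfl
    · simp only [hu, hv, Sum.elim_inr, Fintype.sum_sum_type, Finset.univ_unique,
        Finset.sum_singleton, Sum.elim_inl]
      have hst := state_eq_of_adjugate κ D (fun i => C (U (Sum.inr i) (Sum.inl 0))) i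
      have hD : ∀ j, D i j = C (U (Sum.inr i) (Sum.inr j)) := fun j => by
        simp [D, Matrix.toBlocks₂₂]
      simp only [hD] at hst
      rw [mul_comm ((1 - D * blockVar κ).det) _] at hst
      exact hst
  -- unitarity: `Σ_k conj(U k l') U k l = δ`
  have hUU : ∀ l l' : Fin 1 ⊕ Fin R,
      (∑ k, C (U k l) * C (starRingEnd ℂ (U k l')) : MvPolynomial (σ ⊕ σ) ℂ) =
        if l = l' then 1 else 0 := by
    intro l l'
    have h := Matrix.mem_unitaryGroup_iff'.mp hU
    have hent := congrFun (congrFun h l') l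
    rw [Matrix.mul_apply, Matrix.one_apply] at hent
    have hsum : (∑ k, C (U k l) * C (starRingEnd ℂ (U k l')) : MvPolynomial (σ ⊕ σ) ℂ) =
        C (∑ k, star U l' k * U k l) := by
      rw [map_sum]
      refine Finset.sum_congr rfl fun k _ => ?_
      rw [← map_mul, Matrix.star_apply, mul_comm]
      rfl
    rw [hsum, hent]
    by_cases hll : l = l'
    · subst hll; simp
    · rw [if_neg (Ne.symm hll), if_neg hll, map_zero]
  -- the formal Hermitian pairing is preserved: `⟪u, u⟫ = ⟪v, v⟫`
  have hpair : ∑ k, ι₁ (u k) * ι₂ (u k) = ∑ l, ι₁ (v l) * ι₂ (v l) := by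
    have hexp : ∀ k, ι₁ (u k) * ι₂ (u k) =
        ∑ l, ∑ l', (C (U k l) * C (starRingEnd ℂ (U k l'))) * (ι₁ (v l) * ι₂ (v l')) := by
      intro k
      rw [huv k, map_sum, map_sum, Finset.sum_mul]
      refine Finset.sum_congr rfl fun l _ => ?_
      rw [Finset.mul_sum]
      refine Finset.sum_congr rfl fun l' _ => ?_
      rw [hι₁C, hι₂C]
      ring
    calc ∑ k, ι₁ (u k) * ι₂ (u k)
        = ∑ k, ∑ l, ∑ l', (C (U k l) * C (starRingEnd ℂ (U k l'))) * (ι₁ (v l) * ι₂ (v l')) :=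
          Finset.sum_congr rfl fun k _ => hexp k
      _ = ∑ l, ∑ l', (∑ k, C (U k l) * C (starRingEnd ℂ (U k l'))) * (ι₁ (v l) * ι₂ (v l')) := by
          rw [Finset.sum_comm]
          refine Finset.sum_congr rfl fun l _ => ?_
          rw [Finset.sum_comm]
          refine Finset.sum_congr rfl fun l' _ => ?_
          rw [Finset.sum_mul]
      _ = ∑ l, ι₁ (v l) * ι₂ (v l) := by
          refine Finset.sum_congr rfl fun l _ => ?_
          simp only [hUU, ite_mul, one_mul, zero_mul, Finset.sum_ite_eq, Finset.mem_univ, if_true]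
  -- read off both pairings
  simp only [hu, hv, Fintype.sum_sum_type, Finset.univ_unique, Finset.sum_singleton,
    Sum.elim_inl, Sum.elim_inr, hι₁X, hι₂X] at hpair
  -- `hpair : ι₁ r * ι₂ r + Σ ι₁ G_i ι₂ G_i = ι₁ s * ι₂ s + Σ (X_inl X_inr) ι₁ G_i ι₂ G_i`
  have hfin : ι₁ s * ι₂ s - ι₁ r * ι₂ r =
      ∑ i, (1 - X (Sum.inl (κ i)) * X (Sum.inr (κ i))) * (ι₁ (G i) * ι₂ (G i)) := by
    have hsplit : ∑ i, (1 - X (Sum.inl (κ i)) * X (Sum.inr (κ i))) * (ι₁ (G i) * ι₂ (G i)) =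
        ∑ i, ι₁ (G i) * ι₂ (G i) -
          ∑ i, X (Sum.inl (κ i)) * ι₁ (G i) * (X (Sum.inr (κ i)) * ι₂ (G i)) := by
      rw [← Finset.sum_sub_distrib]
      refine Finset.sum_congr rfl fun i _ => ?_
      ring
    rw [hsplit]
    linear_combination (norm := ring_nf) -hpair
  simpa [hι₁, hι₂] using hfin

end Literature.Analysis.OperatorTheory

end
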